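import Summits.KontsevichZagierPeriods.KontsevichZagierPeriods.Theorems.ValuedFieldSpecialisationParametricLiftingGradedBootstrap
import Summits.KontsevichZagierPeriods.KontsevichZagierPeriods.Theorems.ValuedFieldSpecialisationParametricLiftingStrataLevelTwoPairs
import Summits.KontsevichZagierPeriods.KontsevichZagierPeriods.Theorems.ValuedFieldSpecialisationParametricLiftingStrataSameDimMerge
import Summits.KontsevichZagierPeriods.KontsevichZagierPeriods.Theorems.LiouvilleUnfoldingAyoubPiLocalKernelDimensionLadder
import Summits.KontsevichZagierPeriods.KontsevichZagierPeriods.Theorems.AbelContractionRealHyperellipticSectorPortDimOneAssembly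
import Summits.KontsevichZagierPeriods.KontsevichZagierPeriods.Theses.LowDimension
import Summits.KontsevichZagierPeriods.KontsevichZagierPeriods.Theses.DessinsDimensionOne
import Summits.KontsevichZagierPeriods.KontsevichZagierPeriods.Theorems.AbelContractionRealArcKernelSplit
import Literature.NumberTheory.Transcendental.KZRelationsLE

/-!
# Route ValuedFieldSpecialisation — crux `ParametricLifting` (stmt-KontsevichZagierPeriods-3498):
# THE RUNGS OF THE GRADED OPEN CORE ARE THE DIMENSION STRATA OF THE SUMMIT (lead c8)

Helper (`--supports`) for item stmt-KontsevichZagierPeriods-3498, line `registered`. Lead c7 reshaped the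
crux into the GRADED REGULARISED LIFTING RLG(`E`) (kernel form; level `E` = the subgroup of `KZ.FormalRep`
generated by the representations of dimension `< E`), proved `RLG ∧ SF ⇔ KZKernelConjecture ⇔ summit`
(`…GradedBootstrap.lean`) and left the ladder "`E ≤ 1` theorem, `E = 2` one-dimensional periods, `E ≥ 3`
open" as prose. This file MAKES THE LADDER A THEOREM and identifies its rungs with items other routes of the
summit already hold, so that no new item is needed for the first open rung:

* `regLiftGraded_of_kernelLevel` — for every `E`, Conjecture 1 in kernel form on level `E`
  (`KL(E)`: every value-`0` combination of representations of dimension `< E` is a relation) gives RLG(`E`)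
  (the EMPTY net certifies it);
* `kernelLevel_succ_iff_kzKernel_dim_le`, `kernelLevel_succ_iff_volumeConjecture` — level `d + 1` of this
  route is the rung `d` of the dimension ladder of route LiouvilleUnfolding
  (`NilradicalCut.kzKernel_dim_le_iff_volumeConjecture_succ`, the graded Cresson–Viu-Sos principle): it is
  EQUIVALENT to the volume conjecture for compact `ℚ`-semialgebraic bodies of `ℝ^{d+1}`; hence
  `regLiftGraded_succ_of_volumeConjecture` and the closed form `regLiftGraded_of_forall_volumeConjecture`
  (RLG at ALL levels from the volume conjecture in all dimensions `≥ 2`; levels `≤ 1` are c7's theorem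
  `regLiftGraded_of_le_one`), `kontsevichZagierPeriods_iff_forall_volumeConjecture` (the summit, graded);
* `kernelLevel_succ_succ_iff_pairs` — with the same-dimension merge `stub_sameDimMerge` (landed p167717):
  for `d ≥ 0`, `KL(d + 2)` is Conjecture 1 in PAIR form for representations of dimension `≤ d + 1`
  (kernel form ⇔ pair form at matching levels, the restatement device asked for by lead c7);
* **the first open rung `E = 2` (one-dimensional representations = real 1-periods) IS:**
  `kernelLevelTwo_iff_planarAreas` — item `LowDimension.PlanarAreas` (stmt-KontsevichZagierPeriods-4990,
  "Huber–Wüstholz transferred", shared with SymplecticScissors); `planarAreas_iff_dimLeOnePairs` — Conjecture 1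
  for all pairs of dimension `≤ 1` (so the closed transfer item stmt-0117 is an equivalence);
  `kernelLevelTwo_of_dimLeOneBudgetTwo` — implied by `DessinsDimensionOne.DimLeOneBudgetTwo` (stmt-6261);
  `regLiftGraded_two_of_kzDimTwo` — implied by the shared crux `KZDimTwo` (stmt-4280, via route AbelContraction's
  `RealArcKernelSplit.planarAreas_of_kzDimTwo`);
  (route LiouvilleUnfolding's `…RungOne.lean` adds: implied by `SymplecticScissors.RealOnePeriodRelations`,
  stmt-10042, Huber–Wüstholz in real clothes); and its RATIONAL sub-rung is a THEOREM:
  `kernelLevelTwo_rational` / `regLiftGraded_two_rational` (Baker; `Port.Dlog.mem_relationsLE_of_eval_eq_zero_of_dim_le_one`);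
  whence `regLiftGraded_two_of_planarAreas`, `…_of_kzDimTwo`, `…_of_dimLeOneBudgetTwo`,
  `regLiftGraded_le_two_of_planarAreas`.

Reading for the planner: RESTATE crux 3498 as RLG on levels `≥ 3`; its level `2` is stmt-4990 (equivalently
stmt-10042's consequence, or stmt-6261, or the shared stmt-4280), its levels `≤ 1` are closed.

Sources: M. Kontsevich, D. Zagier, *Periods* (2001), §1.2 Conjecture 1; J. Cresson, J. Viu-Sos, JTNB 34 (2022),
§1 (volume conjecture); J. Viu-Sos, IJNT 17 (2021), Thm. 1.1; A. Huber, G. Wüstholz, *Transcendence and linear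
relations of 1-periods* (2022), Thm. 13.3; A. Baker, *Transcendental Number Theory* (1975), Thm. 2.1.
No definition is introduced (levels, strata and RLG are inlined, as in `…GradedBootstrap.lean`).
-/

noncomputable section

namespace Summit.KontsevichZagierPeriods.ValuedFieldSpecialisation

open MeasureTheory Set Filter
open scoped Topology
open Literature.NumberTheory.Transcendental
open Summit.KontsevichZagierPeriods.KontsevichZagierPeriods.Theses.LowDimension (PlanarAreas)
open Summit.KontsevichZagierPeriods.KontsevichZagierPeriods.Theses.DessinsDimensionOne (DimLeOneBudgetTwo)
open Summit.KontsevichZagierPeriods.KontsevichZagierPeriods.Theses.AbelContraction (KZDimTwo)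
open Summit.KontsevichZagierPeriods.AbelContraction.RealArcKernelSplit (planarAreas_of_kzDimTwo)
open Summit.KontsevichZagierPeriods.LiouvilleUnfolding.NilradicalCut
  (kzKernel_dim_le_iff_volumeConjecture_succ forall_closure_dim_le_iff_forall_bodies_succ
    forall_bodies_succ_iff_forall_integrand_one_succ summit_iff_forall_dim_le)
open Summit.KontsevichZagierPeriods.AbelContraction.RealHyperellipticSector.Port.Dlog
  (mem_relationsLE_of_eval_eq_zero_of_dim_le_one)

/-! ### The empty net: kernel conjecture on a level ⇒ RLG on that level -/

/-- **A relation is certified by the EMPTY regularised net** (on any level `E`): if `x ∈ KZ.relations` then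
the conclusion of RLG(`E`) holds for `x` with `H = 0`, no divergent part and no dominated family
(`−x ∈ KZ.relations`). [cite: KontsevichZagier2001, §1.2 Conjecture 1] -/
theorem exists_emptyNet_of_mem_relations (E : ℕ) {x : KZ.FormalRep} (hx : x ∈ KZ.relations) :
    ∃ H ∈ KZ.fibredRelations, ∃ (k : ℕ) (m : Fin k → ℤ) (p q b d : Fin k → ℕ) (ρ : (i : Fin k) → KZ.IntegralRep (d i)) (P : (i : Fin k) → KZ.IntegralRep (b i + d i + 1 + 1)) (k₂ : ℕ) (d₂ : Fin k₂ → ℕ) (m₂ : Fin k₂ → ℤ) (R : (j : Fin k₂) → KZ.IntegralRep (d₂ j + 1)) (r₀ g : (j : Fin k₂) → KZ.IntegralRep (d₂ j)), (∀ i, 0 < q i ∧ p i < q i ∧ (0 < p i ∨ 0 < b i) ∧ d i + 1 < E ∧ (P i).domain = {z | ∃ (s u : ℝ) (y : Fin (b i) → ℝ) (w : Fin (d i) → ℝ), z = Matrix.vecCons s (Matrix.vecCons u (Fin.append y w)) ∧ 0 < s ∧ s < 1 ∧ 0 < u ∧ u ^ (q i) * s ^ (p i) < 1 ∧ (∀ j,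 s ≤ y j ∧ y j ≤ 1) ∧ w ∈ (ρ i).domain} ∧ (P i).integrand = fun z => (∏ j : Fin (b i), (z (Fin.castAdd (d i) j).succ.succ)⁻¹) * (ρ i).integrand (fun l : Fin (d i) => z (Fin.natAdd (b i) l).succ.succ)) ∧ (∀ j, KZ.IsDominatedFamily (R j) (r₀ j) (g j)) ∧ H = (∑ i, m i • KZ.of (P i)) + (∑ j, m₂ j • KZ.of (R j)) ∧ (∑ j, m₂ j • KZ.of (r₀ j)) - x ∈ KZ.relations := by
  refine ⟨0, KZ.fibredRelations.zero_mem, 0, Fin.elim0, Fin.elim0, Fin.elim0, Fin.elim0, Fin.elim0,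
    fun i => i.elim0, fun i => i.elim0, 0, Fin.elim0, Fin.elim0, fun j => j.elim0, fun j => j.elim0,
    fun j => j.elim0, fun i => i.elim0, fun j => j.elim0, by simp, ?_⟩
  simp only [Finset.univ_eq_empty, Finset.sum_empty, zero_sub]
  exact KZ.relations.neg_mem hx

/-- **Kernel conjecture on level `E` ⇒ RLG(`E`).** If every value-`0` formal combination of
representations of dimension `< E` is a relation, then the graded regularised lifting holds on level `E`
(empty net, `exists_emptyNet_of_mem_relations`). [cite: KontsevichZagier2001, §1.2 Conjecture 1] -/
theorem regLiftGraded_of_kernelLevel (E : ℕ)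
    (hK : ∀ (x : KZ.FormalRep), x ∈ AddSubgroup.closure {y : KZ.FormalRep | ∃ (n : ℕ) (r : KZ.IntegralRep n), n < E ∧ y = KZ.of r} → KZ.eval x = 0 → x ∈ KZ.relations) :
    ∀ (x : KZ.FormalRep), x ∈ AddSubgroup.closure {y : KZ.FormalRep | ∃ (n : ℕ) (r : KZ.IntegralRep n), n < E ∧ y = KZ.of r} → KZ.eval x = 0 → ∃ H ∈ KZ.fibredRelations, ∃ (k : ℕ) (m : Fin k → ℤ) (p q b d : Fin k → ℕ) (ρ : (i : Fin k) → KZ.IntegralRep (d i)) (P : (i : Fin k) → KZ.IntegralRep (b i + d i + 1 + 1)) (k₂ : ℕ) (d₂ : Fin k₂ → ℕ) (m₂ : Fin k₂ → ℤ) (R : (j : Fin k₂) → KZ.IntegralRep (d₂ j + 1)) (r₀ g : (j : Fin k₂) → KZ.IntegralRep (d₂ j)), (∀ i, 0 < q i ∧ p i < q i ∧ (0 < p i ∨ 0 < b i) ∧ d i + 1 < E ∧ (P i).domain = {z | ∃ (s u : ℝ) (y : Fin (b i) → ℝ) (w : Fin (d i) → ℝ), z = Matrix.vecCons s (Matrix.vecCons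 u (Fin.append y w)) ∧ 0 < s ∧ s < 1 ∧ 0 < u ∧ u ^ (q i) * s ^ (p i) < 1 ∧ (∀ j, s ≤ y j ∧ y j ≤ 1) ∧ w ∈ (ρ i).domain} ∧ (P i).integrand = fun z => (∏ j : Fin (b i), (z (Fin.castAdd (d i) j).succ.succ)⁻¹) * (ρ i).integrand (fun l : Fin (d i) => z (Fin.natAdd (b i) l).succ.succ)) ∧ (∀ j, KZ.IsDominatedFamily (R j) (r₀ j) (g j)) ∧ H = (∑ i, m i • KZ.of (P i)) + (∑ j, m₂ j • KZ.of (R j)) ∧ (∑ j, m₂ j • KZ.of (r₀ j)) - x ∈ KZ.relations :=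
  fun x hx hx0 => exists_emptyNet_of_mem_relations E (hK x hx hx0)

/-! ### Level `d + 1` of this route = rung `d` of the dimension ladder -/

/-- The two spellings of a level agree: dimension `< d + 1` and dimension `≤ d` generate the same
subgroup. [folklore] -/
theorem closure_dimLT_succ_eq (d : ℕ) :
    AddSubgroup.closure {y : KZ.FormalRep | ∃ (n : ℕ) (r : KZ.IntegralRep n), n < d + 1 ∧ y = KZ.of r} =
      AddSubgroup.closure {y : KZ.FormalRep | ∃ (m : ℕ) (r : KZ.IntegralRep m), m ≤ d ∧ y = KZ.of r} := by
  congr 1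
  ext y
  simp only [Set.mem_setOf_eq, Nat.lt_succ_iff]

/-- **Level `d + 1` (this route) ⇔ `F_{≤ d}` (route LiouvilleUnfolding's ladder)**: the kernel conjecture on
combinations of representations of dimension `< d + 1` is the kernel conjecture on `F_{≤d}`. [folklore] -/
theorem kernelLevel_succ_iff_kzKernel_dim_le (d : ℕ) :
    (∀ (x : KZ.FormalRep), x ∈ AddSubgroup.closure {y : KZ.FormalRep | ∃ (n : ℕ) (r : KZ.IntegralRep n), n < d + 1 ∧ y = KZ.of r} → KZ.eval x = 0 → x ∈ KZ.relations) ↔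
      ∀ c ∈ AddSubgroup.closure {y : KZ.FormalRep | ∃ (m : ℕ) (r : KZ.IntegralRep m), m ≤ d ∧ y = KZ.of r},
        KZ.eval c = 0 → c ∈ KZ.relations := by
  simp only [closure_dimLT_succ_eq d]

/-- **Level `d + 1` of the graded kernel conjecture ⇔ the volume conjecture in `ℝ^{d+1}`** (two compact
`ℚ`-semialgebraic bodies of `ℝ^{d+1}` of non-empty interior and equal volume are KZ-equivalent): the graded
Cresson–Viu-Sos principle `NilradicalCut.kzKernel_dim_le_iff_volumeConjecture_succ`, in this route's spelling.
[cite: CressonViusos2022, §1 p. 326 Conjecture] -/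
theorem kernelLevel_succ_iff_volumeConjecture (d : ℕ) :
    (∀ (x : KZ.FormalRep), x ∈ AddSubgroup.closure {y : KZ.FormalRep | ∃ (n : ℕ) (r : KZ.IntegralRep n), n < d + 1 ∧ y = KZ.of r} → KZ.eval x = 0 → x ∈ KZ.relations) ↔
      ∀ (K₁ K₂ : KZ.IntegralRep (d + 1)), IsCompact K₁.domain → (interior K₁.domain).Nonempty →
        IsCompact K₂.domain → (interior K₂.domain).Nonempty → (∀ x ∈ K₁.domain, K₁.integrand x = 1) →
        (∀ x ∈ K₂.domain, K₂.integrand x = 1) → K₁.value = K₂.value → KZ.Equivalent K₁ K₂ :=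
  (kernelLevel_succ_iff_kzKernel_dim_le d).trans (kzKernel_dim_le_iff_volumeConjecture_succ d)

/-- **The volume conjecture in `ℝ^{d+1}` ⇒ RLG on level `d + 1`.** [cite: CressonViusos2022, §1 p. 326 Conjecture] -/
theorem regLiftGraded_succ_of_volumeConjecture (D : ℕ)
    (hV : ∀ (K₁ K₂ : KZ.IntegralRep (D + 1)), IsCompact K₁.domain → (interior K₁.domain).Nonempty →
        IsCompact K₂.domain → (interior K₂.domain).Nonempty → (∀ x ∈ K₁.domain, K₁.integrand x = 1) →
        (∀ x ∈ K₂.domain, K₂.integrand x = 1) → K₁.value = K₂.value → KZ.Equivalent K₁ K₂) :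
    ∀ (x : KZ.FormalRep), x ∈ AddSubgroup.closure {y : KZ.FormalRep | ∃ (n : ℕ) (r : KZ.IntegralRep n), n < D + 1 ∧ y = KZ.of r} → KZ.eval x = 0 → ∃ H ∈ KZ.fibredRelations, ∃ (k : ℕ) (m : Fin k → ℤ) (p q b d : Fin k → ℕ) (ρ : (i : Fin k) → KZ.IntegralRep (d i)) (P : (i : Fin k) → KZ.IntegralRep (b i + d i + 1 + 1)) (k₂ : ℕ) (d₂ : Fin k₂ → ℕ) (m₂ : Fin k₂ → ℤ) (R : (j : Fin k₂) → KZ.IntegralRep (d₂ j + 1)) (r₀ g : (j : Fin k₂) → KZ.IntegralRep (d₂ j)), (∀ i, 0 < q i ∧ p i < q i ∧ (0 < p i ∨ 0 < b i) ∧ d i + 1 < D + 1 ∧ (P i).domain = {z | ∃ (s u : ℝ) (y : Fin (b i) → ℝ) (w : Fin (d i) → ℝ), z = Matrix.vecCons s (Matrix.vecCons u (Fin.append y w)) ∧ 0 < s ∧ s < 1 ∧ 0 < u ∧ u ^ (q i) * s ^ (p i) < 1 ∧ (∀ j, s ≤ y j ∧ y j ≤ 1) ∧ w ∈ (ρ i).domain}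 ∧ (P i).integrand = fun z => (∏ j : Fin (b i), (z (Fin.castAdd (d i) j).succ.succ)⁻¹) * (ρ i).integrand (fun l : Fin (d i) => z (Fin.natAdd (b i) l).succ.succ)) ∧ (∀ j, KZ.IsDominatedFamily (R j) (r₀ j) (g j)) ∧ H = (∑ i, m i • KZ.of (P i)) + (∑ j, m₂ j • KZ.of (R j)) ∧ (∑ j, m₂ j • KZ.of (r₀ j)) - x ∈ KZ.relations :=
  regLiftGraded_of_kernelLevel (D + 1) ((kernelLevel_succ_iff_volumeConjecture D).mpr hV)

/-- **RLG at ALL levels from the volume conjecture in all dimensions `≥ 2`**: levels `≤ 1` are c7's theorem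
`regLiftGraded_of_le_one` (constants), level `d + 1 ≥ 2` is `regLiftGraded_succ_of_volumeConjecture`.
[cite: CressonViusos2022, §1 p. 326 Conjecture] -/
theorem regLiftGraded_of_forall_volumeConjecture : (∀ (D : ℕ), 1 ≤ D → ∀ (K₁ K₂ : KZ.IntegralRep (D + 1)), IsCompact K₁.domain → (interior K₁.domain).Nonempty → IsCompact K₂.domain → (interior K₂.domain).Nonempty → (∀ x ∈ K₁.domain, K₁.integrand x = 1) → (∀ x ∈ K₂.domain, K₂.integrand x = 1) → K₁.value = K₂.value → KZ.Equivalent K₁ K₂) → ∀ (E : ℕ) (x : KZ.FormalRep), x ∈ AddSubgroup.closure {y : KZ.FormalRep | ∃ (n : ℕ) (r : KZ.IntegralRep n), n < E ∧ y = KZ.of r} → KZ.eval x = 0 → ∃ H ∈ KZ.fibredRelations, ∃ (k : ℕ) (m : Fin k → ℤ) (p q b d : Fin k → ℕ) (ρ : (i : Fin k) → KZ.IntegralRep (d i)) (P : (i : Fin k) → KZ.IntegralRep (b i + d i + 1 + 1)) (k₂ : ℕ) (d₂ : Fin k₂ → ℕ) (m₂ : Fin k₂ → ℤ) (R : (j :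 Fin k₂) → KZ.IntegralRep (d₂ j + 1)) (r₀ g : (j : Fin k₂) → KZ.IntegralRep (d₂ j)), (∀ i, 0 < q i ∧ p i < q i ∧ (0 < p i ∨ 0 < b i) ∧ d i + 1 < E ∧ (P i).domain = {z | ∃ (s u : ℝ) (y : Fin (b i) → ℝ) (w : Fin (d i) → ℝ), z = Matrix.vecCons s (Matrix.vecCons u (Fin.append y w)) ∧ 0 < s ∧ s < 1 ∧ 0 < u ∧ u ^ (q i) * s ^ (p i) < 1 ∧ (∀ j, s ≤ y j ∧ y j ≤ 1) ∧ w ∈ (ρ i).domain} ∧ (P i).integrand = fun z => (∏ j : Fin (b i), (z (Fin.castAdd (d i) j).succ.succ)⁻¹) * (ρ i).integrand (fun l : Fin (d i) => z (Fin.natAdd (b i) l).succ.succ)) ∧ (∀ j, KZ.IsDominatedFamily (R j) (r₀ j) (g j)) ∧ H = (∑ i, m i • KZ.of (P i)) + (∑ j, m₂ j • KZ.of (R j)) ∧ (∑ j, m₂ j • KZ.of (r₀ j)) - x ∈ KZ.relations := by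
  intro hV E
  rcases Nat.lt_or_ge E 2 with hE | hE
  · exact regLiftGraded_of_le_one E (by omega)
  · obtain ⟨D, rfl⟩ : ∃ D, E = D + 1 := ⟨E - 1, by omega⟩
    exact regLiftGraded_succ_of_volumeConjecture D (hV D (by omega))

/-- **The summit, graded by dimension**: Kontsevich–Zagier's conjecture holds iff the volume conjecture
holds for compact bodies of `ℝ^{d+1}` for every `d` (`NilradicalCut.summit_iff_forall_dim_le` rung by rung).
[cite: CressonViusos2022, §1 p. 326 Conjecture] -/
theorem kontsevichZagierPeriods_iff_forall_volumeConjecture :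
    KontsevichZagierPeriods ↔ ∀ (d : ℕ) (K₁ K₂ : KZ.IntegralRep (d + 1)), IsCompact K₁.domain →
      (interior K₁.domain).Nonempty → IsCompact K₂.domain → (interior K₂.domain).Nonempty →
      (∀ x ∈ K₁.domain, K₁.integrand x = 1) → (∀ x ∈ K₂.domain, K₂.integrand x = 1) →
      K₁.value = K₂.value → KZ.Equivalent K₁ K₂ :=
  summit_iff_forall_dim_le.trans (forall_congr' fun d => kzKernel_dim_le_iff_volumeConjecture_succ d)

/-! ### Kernel form ⇔ pair form at matching levels (same-dimension merge) -/

/-- **Pair normal form on a level.** Every element of level `d + 2` (combinations of representations of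
dimension `≤ d + 1`) is `≡ [a] − [b]` modulo relations with `a`, `b` of dimension EXACTLY `d + 1`: raise
generators by unit slabs (`KZ.IntegralRep.exists_equivalent_of_le`), merge sums inside the dimension
(`stub_sameDimMerge`, p167717), swap for negatives. [cite: KontsevichZagier2001, §1.2 rules (1)–(3)] -/
theorem exists_pair_of_mem_closure_dimLT (d : ℕ) {x : KZ.FormalRep}
    (hx : x ∈ AddSubgroup.closure {y : KZ.FormalRep | ∃ (n : ℕ) (r : KZ.IntegralRep n), n < d + 2 ∧ y = KZ.of r}) :
    ∃ a b : KZ.IntegralRep (d + 1), x - (KZ.of a - KZ.of b) ∈ KZ.relations := by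
  induction hx using AddSubgroup.closure_induction with
  | mem y hy =>
    obtain ⟨n, r, hn, rfl⟩ := hy
    obtain ⟨R, hR⟩ := r.exists_equivalent_of_le (N := d + 1) (by omega)
    refine ⟨R, KZ.IntegralRep.empty (d + 1), ?_⟩
    have : KZ.of r - (KZ.of R - KZ.of (KZ.IntegralRep.empty (d + 1))) =
        (KZ.of r - KZ.of R) + KZ.of (KZ.IntegralRep.empty (d + 1)) := by abel
    rw [this]
    exact KZ.relations.add_mem hR KZ.IntegralRep.of_empty_mem_relations
  | zero => exact ⟨KZ.IntegralRep.empty (d + 1), KZ.IntegralRep.empty (d + 1), by simp⟩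
  | add x y _ _ hx hy =>
    obtain ⟨a₁, b₁, e₁⟩ := hx
    obtain ⟨a₂, b₂, e₂⟩ := hy
    obtain ⟨a, ea⟩ := stub_sameDimMerge d a₁ a₂
    obtain ⟨b, eb⟩ := stub_sameDimMerge d b₁ b₂
    refine ⟨a, b, ?_⟩
    have : x + y - (KZ.of a - KZ.of b) = (x - (KZ.of a₁ - KZ.of b₁)) + (y - (KZ.of a₂ - KZ.of b₂)) +
        (KZ.of a₁ + KZ.of a₂ - KZ.of a) - (KZ.of b₁ + KZ.of b₂ - KZ.of b) := by abel
    rw [this]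
    exact KZ.relations.sub_mem (KZ.relations.add_mem (KZ.relations.add_mem e₁ e₂) ea) eb
  | neg x _ hx =>
    obtain ⟨a, b, e⟩ := hx
    refine ⟨b, a, ?_⟩
    have : -x - (KZ.of b - KZ.of a) = -(x - (KZ.of a - KZ.of b)) := by abel
    rw [this]
    exact KZ.relations.neg_mem e

/-- **Kernel form ⇔ pair form at matching levels.** For every `d`, the kernel conjecture on level `d + 2`
(dimension `≤ d + 1`) is equivalent to Conjecture 1 for PAIRS of representations of dimension `≤ d + 1`
with equal values (any excursion): pairs are combinations; conversely a value-`0` combination is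
`≡ [a] − [b]` in dimension `d + 1` (`exists_pair_of_mem_closure_dimLT`) with `a.value = b.value` by soundness.
The level `2` case is `stub_kernelLevelTwo_iff_dimLeOnePairs` (p167442). [cite: KontsevichZagier2001, §1.2 Conjecture 1] -/
theorem kernelLevel_succ_succ_iff_pairs (d : ℕ) :
    (∀ (x : KZ.FormalRep), x ∈ AddSubgroup.closure {y : KZ.FormalRep | ∃ (n : ℕ) (r : KZ.IntegralRep n), n < d + 2 ∧ y = KZ.of r} → KZ.eval x = 0 → x ∈ KZ.relations) ↔
      ∀ ⦃n m : ℕ⦄, n ≤ d + 1 → m ≤ d + 1 → ∀ (r : KZ.IntegralRep n) (r' : KZ.IntegralRep m),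
        r.value = r'.value → KZ.Equivalent r r' := by
  constructor
  · intro hK n m hn hm r r' hv
    refine hK _ (AddSubgroup.sub_mem _ (AddSubgroup.subset_closure ⟨n, r, by omega, rfl⟩)
      (AddSubgroup.subset_closure ⟨m, r', by omega, rfl⟩)) ?_
    rw [map_sub, KZ.eval_of, KZ.eval_of, hv, sub_self]
  · intro hP x hx hx0
    obtain ⟨a, b, e⟩ := exists_pair_of_mem_closure_dimLT d hx
    have hker := AddMonoidHom.mem_ker.mp (KZ.relations_le_ker_eval_holds e)
    rw [map_sub, hx0, zero_sub, neg_eq_zero, map_sub, KZ.eval_of, KZ.eval_of, sub_eq_zero] at hker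
    have hab : KZ.of a - KZ.of b ∈ KZ.relations := hP le_rfl le_rfl a b hker
    have : x = (x - (KZ.of a - KZ.of b)) + (KZ.of a - KZ.of b) := by abel
    rw [this]
    exact KZ.relations.add_mem e hab

/-! ### The first open rung `E = 2`: one-dimensional representations (real 1-periods) -/

/-- **Level 2 ⇔ `PlanarAreas` (stmt-KontsevichZagierPeriods-4990).** The kernel conjecture for combinations of
representations of dimension `≤ 1` is EQUIVALENT to "two planar `ℚ`-semialgebraic sets of equal (finite)
area are KZ-equivalent": the ladder rung `d = 1` (`forall_closure_dim_le_iff_forall_bodies_succ`) together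
with "compactness is immaterial" (`forall_bodies_succ_iff_forall_integrand_one_succ`).
[cite: CressonViusos2022, §1 p. 326 Conjecture] -/
theorem kernelLevelTwo_iff_planarAreas :
    (∀ (x : KZ.FormalRep), x ∈ AddSubgroup.closure {y : KZ.FormalRep | ∃ (n : ℕ) (r : KZ.IntegralRep n), n < 2 ∧ y = KZ.of r} → KZ.eval x = 0 → x ∈ KZ.relations) ↔
      PlanarAreas := by
  have key := (forall_closure_dim_le_iff_forall_bodies_succ 1 (fun x => x = 0)).trans
    (forall_bodies_succ_iff_forall_integrand_one_succ 1 (fun x => x = 0))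
  simp only [sub_eq_zero, KZ.toFormalPeriod_eq_zero_iff, KZ.toFormalPeriod_eq_iff] at key
  exact (kernelLevel_succ_iff_kzKernel_dim_le 1).trans key

/-- **`PlanarAreas` ⇔ Conjecture 1 for all pairs of dimension `≤ 1`** — so the closed transfer item
`LowDimension.LowdimHuberWustholzTransfer` (stmt-0117, `PlanarAreas →` pairs of dimension `1`) is an
equivalence. [cite: HuberWustholz2022, Thm. 13.3] -/
theorem planarAreas_iff_dimLeOnePairs :
    PlanarAreas ↔ ∀ ⦃n m : ℕ⦄, n ≤ 1 → m ≤ 1 → ∀ (r : KZ.IntegralRep n) (r' : KZ.IntegralRep m),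
      r.value = r'.value → KZ.Equivalent r r' :=
  kernelLevelTwo_iff_planarAreas.symm.trans stub_kernelLevelTwo_iff_dimLeOnePairs

/-- **`PlanarAreas` (stmt-4990) ⇒ RLG on level 2.** [cite: HuberWustholz2022, Thm. 13.3] -/
theorem regLiftGraded_two_of_planarAreas (h : PlanarAreas) :
    ∀ (x : KZ.FormalRep), x ∈ AddSubgroup.closure {y : KZ.FormalRep | ∃ (n : ℕ) (r : KZ.IntegralRep n), n < 2 ∧ y = KZ.of r} → KZ.eval x = 0 → ∃ H ∈ KZ.fibredRelations, ∃ (k : ℕ) (m : Fin k → ℤ) (p q b d : Fin k → ℕ) (ρ : (i : Fin k) → KZ.IntegralRep (d i)) (P : (i : Fin k) → KZ.IntegralRep (b i + d i + 1 + 1)) (k₂ : ℕ) (d₂ : Fin k₂ → ℕ) (m₂ : Fin k₂ → ℤ) (R : (j : Fin k₂) → KZ.IntegralRep (d₂ j + 1)) (r₀ g : (j : Fin k₂) → KZ.IntegralRep (d₂ j)), (∀ i, 0 < q i ∧ p i < q i ∧ (0 < p i ∨ 0 < b i) ∧ d i + 1 < 2 ∧ (P i).domain = {z | ∃ (s u :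 ℝ) (y : Fin (b i) → ℝ) (w : Fin (d i) → ℝ), z = Matrix.vecCons s (Matrix.vecCons u (Fin.append y w)) ∧ 0 < s ∧ s < 1 ∧ 0 < u ∧ u ^ (q i) * s ^ (p i) < 1 ∧ (∀ j, s ≤ y j ∧ y j ≤ 1) ∧ w ∈ (ρ i).domain} ∧ (P i).integrand = fun z => (∏ j : Fin (b i), (z (Fin.castAdd (d i) j).succ.succ)⁻¹) * (ρ i).integrand (fun l : Fin (d i) => z (Fin.natAdd (b i) l).succ.succ)) ∧ (∀ j, KZ.IsDominatedFamily (R j) (r₀ j) (g j)) ∧ H = (∑ i, m i • KZ.of (P i)) + (∑ j, m₂ j • KZ.of (R j)) ∧ (∑ j, m₂ j • KZ.of (r₀ j)) - x ∈ KZ.relations :=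
  regLiftGraded_of_kernelLevel 2 (kernelLevelTwo_iff_planarAreas.mpr h)

/-- **`PlanarAreas` ⇒ RLG on every level `E ≤ 2`** (with c7's `regLiftGraded_of_le_one`).
[cite: HuberWustholz2022, Thm. 13.3] -/
theorem regLiftGraded_le_two_of_planarAreas (h : PlanarAreas) :
    ∀ (E : ℕ), E ≤ 2 → ∀ (x : KZ.FormalRep), x ∈ AddSubgroup.closure {y : KZ.FormalRep | ∃ (n : ℕ) (r : KZ.IntegralRep n), n < E ∧ y = KZ.of r} → KZ.eval x = 0 → ∃ H ∈ KZ.fibredRelations, ∃ (k : ℕ) (m : Fin k → ℤ) (p q b d : Fin k → ℕ) (ρ : (i : Fin k) → KZ.IntegralRep (d i)) (P : (i : Fin k) → KZ.IntegralRep (b i + d i + 1 + 1)) (k₂ : ℕ) (d₂ : Fin k₂ → ℕ) (m₂ : Fin k₂ → ℤ) (R : (j : Fin k₂) → KZ.IntegralRep (d₂ j + 1)) (r₀ g : (j : Fin k₂) → KZ.IntegralRep (d₂ j)), (∀ i, 0 < q i ∧ p i < q i ∧ (0 < p i ∨ 0 < b i) ∧ d i + 1 < E ∧ (P i).domain = {z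 | ∃ (s u : ℝ) (y : Fin (b i) → ℝ) (w : Fin (d i) → ℝ), z = Matrix.vecCons s (Matrix.vecCons u (Fin.append y w)) ∧ 0 < s ∧ s < 1 ∧ 0 < u ∧ u ^ (q i) * s ^ (p i) < 1 ∧ (∀ j, s ≤ y j ∧ y j ≤ 1) ∧ w ∈ (ρ i).domain} ∧ (P i).integrand = fun z => (∏ j : Fin (b i), (z (Fin.castAdd (d i) j).succ.succ)⁻¹) * (ρ i).integrand (fun l : Fin (d i) => z (Fin.natAdd (b i) l).succ.succ)) ∧ (∀ j, KZ.IsDominatedFamily (R j) (r₀ j) (g j)) ∧ H = (∑ i, m i • KZ.of (P i)) + (∑ j, m₂ j • KZ.of (R j)) ∧ (∑ j, m₂ j • KZ.of (r₀ j)) - x ∈ KZ.relations := by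
  intro E hE
  rcases Nat.lt_or_ge E 2 with hE' | hE'
  · exact regLiftGraded_of_le_one E (by omega)
  · obtain rfl : E = 2 := le_antisymm hE hE'
    exact regLiftGraded_two_of_planarAreas h

/-- **The shared crux `KZDimTwo` (stmt-KontsevichZagierPeriods-4280) ⇒ RLG on level 2** (planar volume
representations are rational of dimension `2`: `RealArcKernelSplit.planarAreas_of_kzDimTwo`, route AbelContraction;
the two routes' copies of the shared items agree definitionally). [cite: KontsevichZagier2001, §1.2 Conjecture 1] -/
theorem regLiftGraded_two_of_kzDimTwo (h : KZDimTwo) :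
    ∀ (x : KZ.FormalRep), x ∈ AddSubgroup.closure {y : KZ.FormalRep | ∃ (n : ℕ) (r : KZ.IntegralRep n), n < 2 ∧ y = KZ.of r} → KZ.eval x = 0 → ∃ H ∈ KZ.fibredRelations, ∃ (k : ℕ) (m : Fin k → ℤ) (p q b d : Fin k → ℕ) (ρ : (i : Fin k) → KZ.IntegralRep (d i)) (P : (i : Fin k) → KZ.IntegralRep (b i + d i + 1 + 1)) (k₂ : ℕ) (d₂ : Fin k₂ → ℕ) (m₂ : Fin k₂ → ℤ) (R : (j : Fin k₂) → KZ.IntegralRep (d₂ j + 1)) (r₀ g : (j : Fin k₂) → KZ.IntegralRep (d₂ j)), (∀ i, 0 < q i ∧ p i < q i ∧ (0 < p i ∨ 0 < b i) ∧ d i + 1 < 2 ∧ (P i).domain = {z | ∃ (s u : ℝ) (y : Fin (b i) → ℝ) (w : Fin (d i) → ℝ), z = Matrix.vecCons s (Matrix.vecCons u (Fin.append y w)) ∧ 0 < s ∧ s < 1 ∧ 0 < u ∧ u ^ (q i) * s ^ (p i) < 1 ∧ (∀ j, s ≤ y j ∧ y j ≤ 1) ∧ w ∈ (ρ i).domain}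 ∧ (P i).integrand = fun z => (∏ j : Fin (b i), (z (Fin.castAdd (d i) j).succ.succ)⁻¹) * (ρ i).integrand (fun l : Fin (d i) => z (Fin.natAdd (b i) l).succ.succ)) ∧ (∀ j, KZ.IsDominatedFamily (R j) (r₀ j) (g j)) ∧ H = (∑ i, m i • KZ.of (P i)) + (∑ j, m₂ j • KZ.of (R j)) ∧ (∑ j, m₂ j • KZ.of (r₀ j)) - x ∈ KZ.relations :=
  regLiftGraded_two_of_planarAreas (planarAreas_of_kzDimTwo h)

/-- **`DimLeOneBudgetTwo` (stmt-KontsevichZagierPeriods-6261, Conjecture 1 for pairs of dimension `≤ 1` inside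
the budget `2`) ⇒ the kernel conjecture on level 2** (truncated relations are relations).
[cite: KontsevichZagier2001, §1.2 Conjecture 1] -/
theorem kernelLevelTwo_of_dimLeOneBudgetTwo (h : DimLeOneBudgetTwo) :
    ∀ (x : KZ.FormalRep), x ∈ AddSubgroup.closure {y : KZ.FormalRep | ∃ (n : ℕ) (r : KZ.IntegralRep n), n < 2 ∧ y = KZ.of r} → KZ.eval x = 0 → x ∈ KZ.relations :=
  stub_kernelLevelTwo_iff_dimLeOnePairs.mpr fun _ _ hn hm r r' hv =>
    KZ.relationsLE_le_relations 2 (h hn hm r r' hv)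

/-- **`DimLeOneBudgetTwo` (stmt-6261) ⇒ RLG on level 2.** [cite: KontsevichZagier2001, §1.2 Conjecture 1] -/
theorem regLiftGraded_two_of_dimLeOneBudgetTwo (h : DimLeOneBudgetTwo) :
    ∀ (x : KZ.FormalRep), x ∈ AddSubgroup.closure {y : KZ.FormalRep | ∃ (n : ℕ) (r : KZ.IntegralRep n), n < 2 ∧ y = KZ.of r} → KZ.eval x = 0 → ∃ H ∈ KZ.fibredRelations, ∃ (k : ℕ) (m : Fin k → ℤ) (p q b d : Fin k → ℕ) (ρ : (i : Fin k) → KZ.IntegralRep (d i)) (P : (i : Fin k) → KZ.IntegralRep (b i + d i + 1 + 1)) (k₂ : ℕ) (d₂ : Fin k₂ → ℕ) (m₂ : Fin k₂ → ℤ) (R : (j : Fin k₂) → KZ.IntegralRep (d₂ j + 1)) (r₀ g : (j : Fin k₂) → KZ.IntegralRep (d₂ j)), (∀ i, 0 < q i ∧ p i < q i ∧ (0 < p i ∨ 0 < b i) ∧ d i + 1 < 2 ∧ (P i).domain = {z | ∃ (s u : ℝ) (y : Fin (b i) → ℝ) (w : Fin (d i) → ℝ), z = Matrix.vecCons s (Matrix.vecCons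 u (Fin.append y w)) ∧ 0 < s ∧ s < 1 ∧ 0 < u ∧ u ^ (q i) * s ^ (p i) < 1 ∧ (∀ j, s ≤ y j ∧ y j ≤ 1) ∧ w ∈ (ρ i).domain} ∧ (P i).integrand = fun z => (∏ j : Fin (b i), (z (Fin.castAdd (d i) j).succ.succ)⁻¹) * (ρ i).integrand (fun l : Fin (d i) => z (Fin.natAdd (b i) l).succ.succ)) ∧ (∀ j, KZ.IsDominatedFamily (R j) (r₀ j) (g j)) ∧ H = (∑ i, m i • KZ.of (P i)) + (∑ j, m₂ j • KZ.of (R j)) ∧ (∑ j, m₂ j • KZ.of (r₀ j)) - x ∈ KZ.relations :=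
  regLiftGraded_of_kernelLevel 2 (kernelLevelTwo_of_dimLeOneBudgetTwo h)

/-- **The RATIONAL sub-rung of level 2 is a theorem**: a value-`0` formal combination of representations of
KZ's rational shape of dimension `≤ 1` (rational integrands over `ℚ`-semialgebraic subsets of the line, and
constants) is a relation — Baker's theorem inside the budget `relationsLE 1`
(`Port.Dlog.mem_relationsLE_of_eval_eq_zero_of_dim_le_one`). [cite: Baker1975, Thm 2.1] -/
theorem kernelLevelTwo_rational :
    ∀ x ∈ AddSubgroup.closure {y : KZ.FormalRep | ∃ (n : ℕ) (r : KZ.IntegralRep n), n < 2 ∧ r.IsRational ∧ y = KZ.of r},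
      KZ.eval x = 0 → x ∈ KZ.relations := by
  intro x hx hv
  refine KZ.relationsLE_le_relations 1 (mem_relationsLE_of_eval_eq_zero_of_dim_le_one ?_ hv)
  exact AddSubgroup.closure_mono (by rintro _ ⟨n, r, hn, hr, rfl⟩; exact ⟨n, r, by omega, hr, rfl⟩) hx

/-- **RLG on the rational sub-rung of level 2, unconditionally** — the first unconditional content of the
graded open core above the constants: every value-`0` combination of rational representations of
dimension `≤ 1` is certified (by the empty net). [cite: Baker1975, Thm 2.1] -/
theorem regLiftGraded_two_rational :
    ∀ x ∈ AddSubgroup.closure {y : KZ.FormalRep | ∃ (n : ℕ) (r : KZ.IntegralRep n), n < 2 ∧ r.IsRational ∧ y = KZ.of r}, KZ.eval x = 0 → ∃ H ∈ KZ.fibredRelations, ∃ (k : ℕ) (m : Fin k → ℤ) (p q b d : Fin k → ℕ) (ρ : (i : Fin k) → KZ.IntegralRep (d i)) (P : (i : Fin k) → KZ.IntegralRep (b i + d i + 1 + 1)) (k₂ : ℕ) (d₂ : Fin k₂ → ℕ) (m₂ : Fin k₂ → ℤ) (R : (j : Fin k₂) → KZ.IntegralRep (d₂ j + 1)) (r₀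 g : (j : Fin k₂) → KZ.IntegralRep (d₂ j)), (∀ i, 0 < q i ∧ p i < q i ∧ (0 < p i ∨ 0 < b i) ∧ d i + 1 < 2 ∧ (P i).domain = {z | ∃ (s u : ℝ) (y : Fin (b i) → ℝ) (w : Fin (d i) → ℝ), z = Matrix.vecCons s (Matrix.vecCons u (Fin.append y w)) ∧ 0 < s ∧ s < 1 ∧ 0 < u ∧ u ^ (q i) * s ^ (p i) < 1 ∧ (∀ j, s ≤ y j ∧ y j ≤ 1) ∧ w ∈ (ρ i).domain} ∧ (P i).integrand = fun z => (∏ j : Fin (b i), (z (Fin.castAdd (d i) j).succ.succ)⁻¹) * (ρ i).integrand (fun l : Fin (d i) => z (Fin.natAdd (b i) l).succ.succ)) ∧ (∀ j, KZ.IsDominatedFamily (R j) (r₀ j) (g j)) ∧ H = (∑ i, m i • KZ.of (P i)) + (∑ j, m₂ j • KZ.of (R j)) ∧ (∑ j, m₂ j • KZ.of (r₀ j)) - x ∈ KZ.relations :=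
  fun x hx hv => exists_emptyNet_of_mem_relations 2 (kernelLevelTwo_rational x hx hv)

end Summit.KontsevichZagierPeriods.ValuedFieldSpecialisation
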